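import Mathlib
import HarnessLib
import HarnessLib.Audit
import Summits.AnomalousDissipation.Statement
import Summits.AnomalousDissipation.AnomalousDissipation.Theses.LoudWindows
import HarnessLib.Audit.Status.Attr

/-!
Route: DwellLadder

decomp-ad RESIDUAL DECOMPOSITION, generation 7, lens-1 «grading / quantitative ladder» (cell HOME
run/shared/lean/pub/decomp-ad; node HOME/decomp-ad-lens-1/DwellLadder.lean sha256 ef85cfd8…, `lean
check` rc 0 · 0 sorry · 0 warnings, 443 lines; card DwellLadder_NODE.md 498c8645…; BC7 probes 15/15
CLEAN; critic CLEARED 2026-08-30T06:16:09Z; writer check of the lens package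
split_g7/glue_child.lean rc 0 · 0 sorry: the five item texts fully inlined over tree tokens, closes,
refines : RootDecompCycle1D.Autonomisation, shared items ↔ 1D decls := Iff.rfl). CHILD ROUTE of
route-AnomalousDissipation-RootDecompCycle1D refining its layer-2 declared residual 28569
`Autonomisation` := StirredLaw(28627) → S (D-0019: a layer-2 node is refined by a child route, never
by a third layer), ROOT FORM. It suffices to show X = DwellDown ∧ DwellExtraction ∧
StretchSustainment on top of 1D's 28567 StirredLogLaw ∧ 28568 StirredDelog (shared by signature): g6
graded the force CLASS (steady ⊂ stirred ⊂ schedule), g7 grades the CLOCK of the stirred class by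
the dwell length L. Hinge object DwellLaw: fixed smooth div-free mean-zero modes φᵢ, a FIXED FINITE
MENU of steady forces Σ c(m,i)φᵢ, amplitude C₀ / energy cap E / floor ε fixed BEFORE ∀ L ≥ 1, and
for every L a continuous schedule equal to a menu row on every dwell [n(L+1), n(L+1)+L] carrying the
zeroth law in ROOT CURRENCY. Kernel (0 sorry): S ⟹ DwellLaw ⟹ StirredLaw
(dwellLaw_of_anomalousDissipation / stirredLaw_of_dwellLaw), Autonomisation ⟹ DwellDown
(dwellDown_of_autonomisation), refines' (hD hX hS) : Autonomisation, closes' (h₁ h₂ hD hX hS) :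
_root_.AnomalousDissipation := hS (hX (hD (h₂ h₁))). P₁ DwellDown := StirredLaw → DwellLaw is the
NEW declared residual (strictly inside the old edge; idea «kick-and-hold»); P₂ DwellExtraction :=
DwellLaw → 2B.LoudStretches is THEOREM-GRADE (the junction 1D ⟶ 2B: pigeonhole over the finite menu
gives EXACTLY steady loud windows); X StretchSustainment := LoudStretches → S is 2B's residual chain
by meaning (cross-link, not staffed).
Lean: StirredLogLaw → StirredDelog → DwellDown → DwellExtraction → StretchSustainment →
_root_.AnomalousDissipation
(over Literature.Analysis.FunctionSpaces.Torus.{IsSmooth, IsDivFree, HasZeroMean, eGradNormSq,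
fourierTruncate}, Literature.Analysis.FluidPDE.Torus.IsGlobalLerayHopf,
Literature.Analysis.FluidPDE.{meanEnergy, meanDissipation, timeMean}, Filter.Tendsto / atTop / nhds
— every constant confirmed by elaboration of glue_child.lean and the native route check).

Rationale: WHY THIS LINE. Hinge object: `DwellLaw` — fixed modes φᵢ (N, smooth div-free mean-zero), fixed
FINITE MENU c : Fin M → Fin N → ℝ of steady forces f_m = Σ c(m,i)φᵢ, fixed amplitude C₀, energy cap
E, floor ε > 0, and FOR EVERY dwell length L ≥ 1 a dwell schedule (coefficients continuous, |aᵢ| ≤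
C₀, equal to a menu row on every dwell [n(L+1), n(L+1)+L], free unit transitions) carrying the
zeroth law in ROOT CURRENCY (one force for all j, Leray–Hopf, ν_j → 0 chosen AFTER L, limsup Cesàro
means ≤ E / ≥ ε).  Kernel ladder (0 sorry): S ⟹ DwellLaw (`dwellLaw_of_anomalousDissipation`: a
steady force is a dwell schedule of every length) ⟹ StirredLaw 28627 (`stirredLaw_of_dwellLaw`: L =
1) ⟹ StirredLogLaw-antecedents; 28569 ⟹ P₁ (`dwellDown_of_autonomisation`).    28569 Autonomisation
⟸ P₁ DwellDown ∧ P₂ DwellExtraction ∧ X StretchSustainment          (`refines'`; `refines` with X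
unfolded into 2B's three items)   _root_.AnomalousDissipation ⟸ 28567 ∧ 28568 ∧ P₁ ∧ P₂ ∧ X
(`closes'`; `closes` with 2B's items; `closes_1D` over 25193/25195) * Formal:
`dwellDown_of_autonomisation : Autonomisation → DwellDown` (whatever closes 28569 closes P₁); the
converse is not claimed and not visible. * Separating world W_slow-quiet: steadily forced turbulence
at bounded energy quiets down, but only on viscous time-scales ≍ ν^{-a}, and a switch of the
large-scale force resets the quieting.  There, for every fixed L the family ν_j → 0 (chosen after L)
sees loud dwells for ever ⇒ DwellLaw and P₁ hold,   while a steadily forced family's limsup means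
see the quiet end-state ⇒ S and 28569 fail.  (This is 2B's world W_quiet seen from the force side;
the   node makes the two ledgers share it instead of each carrying a private copy.) * Failure world
W_kick (what would refute P₁): kicked states re-laminarise in O(1) time at bounded energy for all
small ν; then dwell-interior   dissipation ≍ 1/L and DwellLaw is false — note W_kick kills S as well
(through 26353), so P₁ is never «harder than S». * Not cheap (E1 of 1B:24734 respected): constants
(menu, C₀, E, ε) are fixed BEFORE ∀ L.  A single-shell menu row loads its Stokes mode like C₀·t
during   a dwell at small ν (energy ≍ C₀²L², not uniform in L); finite rank excludes the
resonance-schedule witness 28628; exact ν-independence of the force   excludes the 2½-D catalytic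
witnesses (ν-dependent data are allowed, but catalysts die on viscous times and limsup means are
infinite-time).  No   laminar / heat-flow witness of DwellLaw is known to the cell (A₂ in the file
header). * Why the menu is FINITE and not merely compact (slow drift |aᵢ'| ≤ δ): with a compact menu
step (4) is compactness and the extraction lands on forces   only CONVERGING to f_* on the windows;
removing a vanishing smooth perturbation from loud bounded Leray–Hopf windows at ν → 0 is a
force-continuity   statement for non-unique weak solutions — not theorem-grade and
ForceRobust-adjacent.  Finiteness buys EXACT steadiness on windows by pigeonhole.   (Recorded as
text aside A₁; the slow-drift class is deliberately NOT filed.)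

RANKED CRUXES. #2 DwellDown (P₁; declared residual; WEAKER by kernel; IDEA-NEEDED kick-and-hold +
INSTRUMENTABLE T-DWELL) · #3 DwellExtraction (P₂; THEOREM-GRADE L, ATTACKABLE NOW, BC3 skeleton with
stubs X1/X2 and proved composition) · #4 StirredLogLaw (shared 1D:28567, the attacked rung of the
parent) · #5 StirredDelog (shared 1D:28568, undecided) · support 9 StretchSustainment (X = 2B's
26352 ∘ 26353 ∘ 26354, cross-link, binder of closes, not staffed).

KILL CRITERIA. P₁ dies in world W_kick (kicked states re-laminarise in O(1) time at bounded energy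
for all small ν: dwell-interior dissipation ≍ 1/L) — census T-DWELL falsifier «ε_int decreasing in L
like 1/L or E_int growing with L»; note W_kick kills S as well through 2B:26353, so the route is
never harder than S. P₂ can only fail by a typing slip (torus/forced twin of IsLerayHopfOn.concat).
A proof that NO finite menu of single-shell rows satisfies DwellLaw (TwohalfdNeg row by row) PRICES
P₁ (genuinely 3-D responses needed), it does not kill it.

NOT DECOMPOSED YET. P₁ (the kick-and-hold mechanism is one statement; a further grade would be the
transition protocol, deliberately left free); the slow-drift variant A₁ (compact menu) is NOT filed
— it would reopen a force-continuity removal residual (ForceRobust-adjacent); planar / single-shell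
menus are excluded as text asides A₂/A₃.

CHEAPEST FALSIFIER. T-DWELL (census-1): 3-D NSE on 𝕋³, N ∈ {128, 256}, menu of two Kolmogorov rows
alternated with dwell L ∈ {5, 20, 80} large-eddy times, ν over a factor 8; PREDICTION ε_int(L, ν)
within ±15 % of ε_steady(ν) for all L, ν with E_int bounded; FALSIFIER ε_int ∝ 1/L or E_int growing
with L; 2-D control predicted false (condensate).

Novelty: Tree: `rg -n "dwell|switch|piecewise.*stead|quasi-static|adiabatic|modulated"` over Theses/ and
Literature/Analysis/FluidPDE: no statement quantifying over piecewise-steady / switched forces;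
`ZerothLawTimePeriodic` (S03) is periodic forcing at fixed period, ClockedKolmogorov / DopplerClock
(retired) clock ONE mode; 1D rev 2 (my g6) has the class ladder but no clock grade.  Cell: lens-5/2B
reach LoudStretches from PREPARED DATA under a steady force, lens-6/1C/InviscidWork from DESIGNED
ν-dependent forces, lens-3 from certificates, lens-4 from symmetry trimming, lens-2 pins
Taylor–Green — nobody lands in 2B's window currency from a FORCE-CLASS ladder, and no junction
theorem 1D → 2B exists (TREE.md v0.8 read).  Print — physics of «modulated turbulence» (response of
ε to slow periodic modulation of the forcing is quasi-static at large periods, resonant near the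
large-eddy time): [graph:doi:10.1103/physreve.67.046308] von der Heydt–Grossmann–Lohse 2003
«Response maxima in modulated turbulence» (+ II, doi:10.1103/ physreve.68.066302),
[graph:doi:10.1209/epl/i2005-10486-2 = arXiv:physics/0509208] Kuczaj–Geurts–Lohse 2006 DNS,
[graph:doi:10.1017/ s0022112003004592] Cadot–Titon–Bonn 2003 (experiment),
[corpus:paper:arxiv-1604.02941 p.10] «Mixing in modulated turbulence», [corpus:paper:
verschoof2018-periodically-driven-taylorcouette-turbulence p.12]; these support the
W_slow-quiet-free picture behind P₁ (quasi-static response) but contain no statement uniform in a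
dwell length at ν  [refs: 10.1103/physreve.67.046308, 10.1209/epl/i2005-10486-2, physics/0509208, doi:10.1103/physreve.67.046308, doi:10.1103/, doi:10.1209/epl/i2005-10486-2, doi:10.1017/, paper:arxiv-1604.02941]

Barriers (technique_class: compactness extraction, Leray-Hopf continuation, switching): - technique_class: compactness/pigeonhole extraction + Leray-Hopf restart-continuation (P2);
switched large-scale forcing (P1)
- Literature.Barriers.AnomalousDissipation.Cheskidov2023_thm13_not_forceRobustNoAnomaly: DwellDown /
DwellExtraction — OUTSIDE: P₂ is a selection argument on GIVEN anomalous runs (no a-priori estimate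
uniform in the force) and P₁ is a construction claim for ONE designed finite-menu force class, not
an estimate over all forces; the force-robustness barrier (tree ForceRobustEstimates.lean) does bite
the UNFILED slow-drift variant A₁ — which is exactly why the menu is FINITE (pigeonhole ⇒ exactly
steady windows, no force-continuity removal) [tree:
Literature/Barriers/AnomalousDissipation/ForceRobustEstimates.lean].
- Literature.Barriers.AnomalousDissipation.AlexakisDoering2006_energyDissipationBound: consistent
and used as the NEGATIVE CALIBRATION — planar menus (every row a 2-D field) cannot satisfy DwellLaw
(2-D dissipation ≤ ν·enstrophy budget → 0 at bounded energy; tree TwoDimensionalEnergyDissipation),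
so P₁'s witnesses must be genuinely three-dimensional responses (text aside A₂) [tree:
TwoDimensionalEnergyDissipation.lean].
- Literature.Barriers.AnomalousDissipation.Marchioro1986_globalAttraction: DwellDown — a menu
consisting of ONE gravest-mode row is a steady gravest-mode force with a globally attracting laminar
state at every ν (no floor); excluded by shape (≥ 2 distinct rows, switches) and recorded as aside
A₃; single-shell rows are priced by

sub-problem: AnomalousDissipation · status: draft · opened planner-decomp-ad-writer-1-g3-0 2026-08-30T06:22:11Z · rev 3 · ledger route-AnomalousDissipation-DwellLadder
GENERATED by the gate from the ledger (D-0016/17). Provers cite these decls: `theorem foo : Summit.AnomalousDissipation.AnomalousDissipation.Theses.DwellLadder.<Decl> := …` in Summits/AnomalousDissipation/AnomalousDissipation/Theorems/<Name>.lean.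
-/

namespace Summit.AnomalousDissipation.AnomalousDissipation.Theses.DwellLadder

open scoped BigOperators Topology Manifold Classical MeasureTheory ProbabilityTheory Matrix InnerProductSpace ComplexConjugate ContinuousMap
open Filter Set Function TopologicalSpace MeasureTheory

attribute [summit_statement] _root_.AnomalousDissipation

open Literature.Turb

/-- item stmt-AnomalousDissipation-29225 · crux · rank 2 · open · by planner
why it might fail: W_kick: states kicked by a large-scale force switch may re-laminarise in O(1) time at bounded energy for all small ν, so dwell-interior dissipation decays like 1/L and no constants uniform in L exist (this world kills S too, via 2B:26353).
sources: doi:10.1103/physreve.67.046308, arXiv:physics/0509208, doi:10.1017/s0022112003004592, arXiv:1604.02941, Literature.Barriers.AnomalousDissipation.ForceRobustEstimates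
[crux] [P₁; DECLARED RESIDUAL of this child route = refinement of 1D:28569 Autonomisation (kernel
dwellDown_of_autonomisation : Autonomisation → DwellDown; S ⟹ it); PIECE WEAKER; separating world
W_slow-quiet (steady turbulence quiets only on viscous times, a large-scale switch resets it); LEAF
IDEA-NEEDED («kick-and-hold»: finite-time self-sustainment after a large-scale force switch, uniform
in the dwell length L) + INSTRUMENTABLE (census T-DWELL, prediction in the card); E1 respected:
modes, FINITE menu, amplitude C₀, cap E, floor ε bound BEFORE ∀ L ≥ 1; filed FULLY INLINED (28627
StirredLaw text → DwellLaw text)] [crux; NEW DECLARED RESIDUAL of 1D:28569 Autonomisation; PIECE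
WEAKER (kernel: Autonomisation ⟹ it, DwellLadder.dwellDown_of_autonomisation; S ⟹ it); separating
world W_slow-quiet (steadily forced turbulence quiets only on viscous time-scales, force switches
reset the quieting); LEAF IDEA-NEEDED («kick-and-hold»: finite-time self-sustainment after a
large-scale switch, uniform in the dwell length) + INSTRUMENTABLE (census T-DWELL)] DWELL-DOWN: a
finite-rank smoothly STIRRED zeroth law at bounded energy (28627-text) ⇒ the DWELL LAW: fixed smooth
div-free mean-zero modes -/
@[route_item "route-AnomalousDissipation-DwellLadder", crux]
def DwellDown : Prop :=
  (∃ (E : ℝ) (N : ℕ) (φ : Fin N → UnitAddTorus (Fin 3) → EuclideanSpace ℝ (Fin 3)) (a : Fin N → ℝ → ℝ), (∀ i, Literature.Analysis.FunctionSpaces.Torus.IsSmooth (φ i) ∧ Literature.Analysis.FunctionSpaces.Torus.IsDivFree (φ i) ∧ Literature.Analysis.FunctionSpaces.Torus.HasZeroMean (φ i)) ∧ (∀ i, Continuous (a i)) ∧ (∃ C₀ : ℝ, ∀ i t, |a i t| ≤ C₀) ∧ ∃ (ν : ℕ → ℝ) (u₀ : ℕ → UnitAddTorus (Fin 3) → EuclideanSpace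 ℝ (Fin 3)) (u : ℕ → ℝ → UnitAddTorus (Fin 3) → EuclideanSpace ℝ (Fin 3)), (∀ j, 0 < ν j) ∧ Tendsto ν atTop (𝓝 0) ∧ (∀ j, Literature.Analysis.FluidPDE.Torus.IsGlobalLerayHopf (ν j) (fun t x => ∑ i, a i t • φ i x) (u₀ j) (u j)) ∧ (∀ j, Literature.Analysis.FluidPDE.meanEnergy (u j) ≤ E) ∧ ∃ ε : ℝ, 0 < ε ∧ ∀ j, ε ≤ Literature.Analysis.FluidPDE.meanDissipation (ν j) (u j)) → ∃ (N M : ℕ) (φ : Fin N → UnitAddTorus (Fin 3) → EuclideanSpace ℝ (Fin 3)) (c : Fin M → Fin N → ℝ) (C₀ E ε : ℝ), (∀ i, Literature.Analysis.FunctionSpaces.Torus.IsSmooth (φ i) ∧ Literature.Analysis.FunctionSpaces.Torus.IsDivFree (φ i) ∧ Literature.Analysis.FunctionSpaces.Torus.HasZeroMean (φ i)) ∧ 0 < ε ∧ ∀ L : ℝ, 1 ≤ L → ∃ a : Fin N → ℝ → ℝ, ((∀ i, Continuous (a i)) ∧ (∀ i t, |a i t| ≤ C₀) ∧ ∃ m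 : ℕ → Fin M, ∀ (n : ℕ) (i : Fin N) (t : ℝ), (n : ℝ) * (L + 1) ≤ t → t ≤ (n : ℝ) * (L + 1) + L → a i t = c (m n) i) ∧ ∃ (ν : ℕ → ℝ) (u₀ : ℕ → UnitAddTorus (Fin 3) → EuclideanSpace ℝ (Fin 3)) (u : ℕ → ℝ → UnitAddTorus (Fin 3) → EuclideanSpace ℝ (Fin 3)), (∀ j, 0 < ν j) ∧ Tendsto ν atTop (𝓝 0) ∧ (∀ j, Literature.Analysis.FluidPDE.Torus.IsGlobalLerayHopf (ν j) (fun t x => ∑ i, a i t • φ i x) (u₀ j) (u j)) ∧ (∀ j, Literature.Analysis.FluidPDE.meanEnergy (u j) ≤ E) ∧ ∀ j, ε ≤ Literature.Analysis.FluidPDE.meanDissipation (ν j) (u j)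

/-- item stmt-AnomalousDissipation-29226 · crux · rank 3 · open · by planner
why it might fail: only Lean-size risk: the torus/forced twin of the ℝ³ unforced `IsLerayHopfOn.concat` (energy inequality across the gluing time from an a.e.-good slice) is not yet in tree; mathematically routine.
sources: Hopf1951, RobinsonRodrigoSadowski2016, FMRTTurbulence2001, DoeringFoias2002
[crux] [P₂; THEOREM-GRADE L · ATTACKABLE NOW · the JUNCTION 1D ⟶ 2B (DwellLaw →
RootDecompCycle2B.LoudStretches 26351-text, inlined): ramp lemma + block selection (critic
06:16:09Z: loud blocks must also be energy-good — K = K₀(E, C₀, ε) fixed uniformly in L, j;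
extracted energy constant K₀E) + pigeonhole over the FINITE menu + a.e. restart (tree
LerayHopfRestartTorus) + steady continuation + resolution + diagonal; BC3 birth skeleton
HOME/decomp-ad-lens-1/bc/DwellExtraction_birth.lean d1539dd1… (rc0 · sorries 2 = stubs X1
stub_dwellWindows (L) / X2 stub_steadyContinuation (M–L); timeMean_congr_Icc,
steadyWindows_of_dwellWindows, loudStretches_of_steadyWindows and the composition DwellExtraction_of
PROVED)] [crux; THEOREM-GRADE (size L) · LEAF ATTACKABLE NOW · the JUNCTION 1D ⟶ 2B; birth skeleton
HOME/decomp-ad-lens-1/bc/DwellExtraction_birth.lean (stubs X1 stub_dwellWindows L, X2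
stub_steadyContinuation M–L; window transfer, sequence step and composition DwellExtraction_of
PROVED)] DWELL EXTRACTION: the dwell law ⇒ 2B's LoudStretches (26351-text): ramp lemma ‖u(t)‖ ≤
‖u(s)‖ + Φ(t−s) from the energy inequality ⇒ transitions carry ≤ Tε/8 dissipation for L ≥ L*(E,ε,Φ);
block selection -/
@[route_item "route-AnomalousDissipation-DwellLadder", crux]
def DwellExtraction : Prop :=
  (∃ (N M : ℕ) (φ : Fin N → UnitAddTorus (Fin 3) → EuclideanSpace ℝ (Fin 3)) (c : Fin M → Fin N → ℝ) (C₀ E ε : ℝ), (∀ i, Literature.Analysis.FunctionSpaces.Torus.IsSmooth (φ i) ∧ Literature.Analysis.FunctionSpaces.Torus.IsDivFree (φ i) ∧ Literature.Analysis.FunctionSpaces.Torus.HasZeroMean (φ i)) ∧ 0 < ε ∧ ∀ L : ℝ, 1 ≤ L → ∃ a : Fin N → ℝ → ℝ, ((∀ i, Continuous (a i)) ∧ (∀ i t, |a i t| ≤ C₀) ∧ ∃ m : ℕ → Fin M, ∀ (n : ℕ) (i : Fin N) (t : ℝ), (n : ℝ) * (L + 1) ≤ t → t ≤ (n : ℝ)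 * (L + 1) + L → a i t = c (m n) i) ∧ ∃ (ν : ℕ → ℝ) (u₀ : ℕ → UnitAddTorus (Fin 3) → EuclideanSpace ℝ (Fin 3)) (u : ℕ → ℝ → UnitAddTorus (Fin 3) → EuclideanSpace ℝ (Fin 3)), (∀ j, 0 < ν j) ∧ Tendsto ν atTop (𝓝 0) ∧ (∀ j, Literature.Analysis.FluidPDE.Torus.IsGlobalLerayHopf (ν j) (fun t x => ∑ i, a i t • φ i x) (u₀ j) (u j)) ∧ (∀ j, Literature.Analysis.FluidPDE.meanEnergy (u j) ≤ E) ∧ ∀ j, ε ≤ Literature.Analysis.FluidPDE.meanDissipation (ν j) (u j)) → ∃ (f : UnitAddTorus (Fin 3) → EuclideanSpace ℝ (Fin 3)) (ν : ℕ → ℝ) (E₀ E ε : ℝ), (Literature.Analysis.FunctionSpaces.Torus.IsSmooth f ∧ Literature.Analysis.FunctionSpaces.Torus.IsDivFree f ∧ Literature.Analysis.FunctionSpaces.Torus.HasZeroMean f ∧ (∀ j, 0 < ν j) ∧ Tendsto ν atTop (𝓝 0) ∧ 0 < ε) ∧ ∀ τ : ℝ, ∃ j₀ : ℕ, ∀ j,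 j₀ ≤ j → ∃ T₀ : ℝ, 0 < T₀ ∧ ∃ (K : ℝ → ℕ) (u₀ : UnitAddTorus (Fin 3) → EuclideanSpace ℝ (Fin 3)) (u : ℝ → UnitAddTorus (Fin 3) → EuclideanSpace ℝ (Fin 3)), ∫ x, ‖u₀ x‖ ^ 2 ≤ E₀ ∧ Literature.Analysis.FluidPDE.Torus.IsGlobalLerayHopf (ν j) (fun _ => f) u₀ u ∧ ∀ T : ℝ, T₀ ≤ T → T ≤ T₀ + τ → Literature.Analysis.FluidPDE.timeMean (fun t => ∫ x, ‖u t x‖ ^ 2) T ≤ E ∧ ε ≤ Literature.Analysis.FluidPDE.timeMean (fun t => (ν j) * (Literature.Analysis.FunctionSpaces.Torus.eGradNormSq (Literature.Analysis.FunctionSpaces.Torus.fourierTruncate (K T) (u t))).toReal) T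

/-- item stmt-AnomalousDissipation-28567 · crux · rank 4 · open · by planner
why it might fail: quenched mixing constants of BCZG/CIS are not uniform in the release time; limsup Cesàro means along ONE sample need the stationary extended chain (tracer × projective × two-point × O(√ν) remnant drift) — the drift may spoil two-point controllability at small scales.
sources: arXiv:2204.13651, arXiv:2403.19858, arXiv:2503.05885, arXiv:1806.03699, arXiv:1806.03258, arXiv:1911.11014
[crux · ATTACKED · rank per lens 2] [crux; PIECE WEAKER (kernel: S ⟹ it,
StirLadder.stirredLogLaw_of_anomalousDissipation); LEAF ATTACKABLE (single-shell stirring programme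
SP1–SP4)] STIRRED LOG LAW: the zeroth law (Leray–Hopf families, ν_j → 0, limsup Cesàro means) driven
by ONE finite-rank smooth stirring force F t x = Σ_{i<N} a_i(t)•φ_i(x) (φ_i smooth div-free
mean-zero, a_i continuous bounded; exactly ν-independent), with polylog energy meanEnergy(u_j) ≤ E +
C(1+|log ν_j|)^p and a uniform dissipation floor. [lens-1 g6 StirLadder OPTION B child of 25194
CornerLift; critic CLEARED 2026-08-30T05:31:23Z; files HOME/decomp-ad-lens-1/StirLadder.lean sha256
08235d02…, StirLadder_NODE.md, split_g6/; writer sketch g3/1Ds6/Sketch1D_split.lean (StirredLogLaw_c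
↔ lens StirredLogLawItem := Iff.rfl, ↔ structured StirredLogLaw by the lens iff)] [difficulty: L] -/
@[route_item "route-AnomalousDissipation-DwellLadder", crux]
def StirredLogLaw : Prop :=
  ∃ (E C : ℝ) (p N : ℕ) (φ : Fin N → UnitAddTorus (Fin 3) → EuclideanSpace ℝ (Fin 3)) (a : Fin N → ℝ → ℝ), (∀ i, Literature.Analysis.FunctionSpaces.Torus.IsSmooth (φ i) ∧ Literature.Analysis.FunctionSpaces.Torus.IsDivFree (φ i) ∧ Literature.Analysis.FunctionSpaces.Torus.HasZeroMean (φ i)) ∧ (∀ i, Continuous (a i)) ∧ (∃ C₀ : ℝ, ∀ i t, |a i t| ≤ C₀) ∧ ∃ (ν : ℕ → ℝ) (u₀ : ℕ → UnitAddTorus (Fin 3) → EuclideanSpace ℝ (Fin 3)) (u : ℕ → ℝ → UnitAddTorus (Fin 3) → EuclideanSpace ℝ (Fin 3)), (∀ j, 0 < ν j) ∧ Tendsto ν atTop (𝓝 0) ∧ (∀ j, Literature.Analysis.FluidPDE.Torus.IsGlobalLerayHopf (ν j) (fun t x => ∑ i, a i t • φ i x) (u₀ j) (u j)) ∧ (∀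 j, Literature.Analysis.FluidPDE.meanEnergy (u j) ≤ E + C * (1 + |Real.log (ν j)|) ^ p) ∧ ∃ ε : ℝ, 0 < ε ∧ ∀ j, ε ≤ Literature.Analysis.FluidPDE.meanDissipation (ν j) (u j)

/-- item stmt-AnomalousDissipation-28568 · crux · rank 5 · open · by planner
why it might fail: W_log: every finite-rank stirred anomaly at bounded planar amplitude has uniformly Lipschitz carriers, hence energy ≳ log(1/ν) (Batchelor lower bound); de-logging needs a response that roughens = planar turbulence driven by stirring, open.
sources: arXiv:2503.05885, DrivasEtAl2022, LissMattingly2026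
[crux · UNDECIDED · rank per lens 3 · filed FULLY INLINED (StirredLogLaw text → StirredLaw text);
by-name form: StirredLogLaw → StirredLaw] [crux; PIECE WEAKER-formal (S ⟹ it), UNDECIDED in
substance; LEAF IDEA-NEEDED, BARRIER-adjacent (Lipschitz carriers force the Batchelor logarithm:
MeanSquareLipschitzNoGo p152468, strain/log gates p111103/p91755, SubLogStrain p135209,
Cooperman–Rowan arXiv:2503.05885 Thm 1.1)] STIRRED DE-LOG: at finite-rank stirred autonomy remove
the logarithm — StirredLogLaw → StirredLaw (same, bounded energy). [lens-1 g6 StirLadder OPTION B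
child of 25194 CornerLift; critic CLEARED 2026-08-30T05:31:23Z; files
HOME/decomp-ad-lens-1/StirLadder.lean sha256 08235d02…, StirLadder_NODE.md, split_g6/; writer sketch
g3/1Ds6/Sketch1D_split.lean (StirredDelog_c ↔ lens StirredDelogItem := Iff.rfl, ↔ structured
StirredDelog by the lens iff)] [difficulty: open-p] -/
@[route_item "route-AnomalousDissipation-DwellLadder", crux]
def StirredDelog : Prop :=
  (∃ (E C : ℝ) (p N : ℕ) (φ : Fin N → UnitAddTorus (Fin 3) → EuclideanSpace ℝ (Fin 3)) (a : Fin N → ℝ → ℝ), (∀ i, Literature.Analysis.FunctionSpaces.Torus.IsSmooth (φ i) ∧ Literature.Analysis.FunctionSpaces.Torus.IsDivFree (φ i) ∧ Literature.Analysis.FunctionSpaces.Torus.HasZeroMean (φ i)) ∧ (∀ i, Continuous (a i)) ∧ (∃ C₀ : ℝ, ∀ i t, |a i t| ≤ C₀) ∧ ∃ (ν : ℕ → ℝ) (u₀ : ℕ → UnitAddTorus (Fin 3) → EuclideanSpace ℝ (Fin 3)) (u : ℕ → ℝ → UnitAddTorus (Fin 3) → EuclideanSpace ℝ (Fin 3)),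 (∀ j, 0 < ν j) ∧ Tendsto ν atTop (𝓝 0) ∧ (∀ j, Literature.Analysis.FluidPDE.Torus.IsGlobalLerayHopf (ν j) (fun t x => ∑ i, a i t • φ i x) (u₀ j) (u j)) ∧ (∀ j, Literature.Analysis.FluidPDE.meanEnergy (u j) ≤ E + C * (1 + |Real.log (ν j)|) ^ p) ∧ ∃ ε : ℝ, 0 < ε ∧ ∀ j, ε ≤ Literature.Analysis.FluidPDE.meanDissipation (ν j) (u j)) → (∃ (E : ℝ) (N : ℕ) (φ : Fin N → UnitAddTorus (Fin 3) → EuclideanSpace ℝ (Fin 3)) (a : Fin N → ℝ → ℝ), (∀ i, Literature.Analysis.FunctionSpaces.Torus.IsSmooth (φ i) ∧ Literature.Analysis.FunctionSpaces.Torus.IsDivFree (φ i) ∧ Literature.Analysis.FunctionSpaces.Torus.HasZeroMean (φ i)) ∧ (∀ i, Continuous (a i)) ∧ (∃ C₀ : ℝ, ∀ i t, |a i t| ≤ C₀) ∧ ∃ (ν : ℕ → ℝ) (u₀ : ℕ → UnitAddTorus (Fin 3) → EuclideanSpace ℝ (Fin 3)) (u : ℕ → ℝ → UnitAddTorus (Fin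 3) → EuclideanSpace ℝ (Fin 3)), (∀ j, 0 < ν j) ∧ Tendsto ν atTop (𝓝 0) ∧ (∀ j, Literature.Analysis.FluidPDE.Torus.IsGlobalLerayHopf (ν j) (fun t x => ∑ i, a i t • φ i x) (u₀ j) (u j)) ∧ (∀ j, Literature.Analysis.FluidPDE.meanEnergy (u j) ≤ E) ∧ ∃ ε : ℝ, 0 < ε ∧ ∀ j, ε ≤ Literature.Analysis.FluidPDE.meanDissipation (ν j) (u j))

/-- item stmt-AnomalousDissipation-29227 · support · rank 9 · SPLIT (gen 1) into HorizonExtension, WindowCompactnessLink, PowerRealisesDissipationLink + glue StretchSustainmentGlue · direct attempts still welcome (low priority) · by planner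
why it might fail: exactly 2B's W_fat / W_quiet worlds (26352/26353): loud episodes may end fat or fall into a quiet ν-bounded trap at fixed ν.
sources: DoeringFoias2002, arXiv:1401.5935, FMRTTurbulence2001
[support] [X; CROSS-LINK to route RootDecompCycle2B = 26352 EnergyLanding → 26353 LoudnessRecurrence
→ 26354 WindowBookkeeping composed (lens kernel stretchSustainment_of_2B over
RootDecompCycle2B.closes); NOT separately staffed, not double-counted; antecedent = 26351
LoudStretches text verbatim; a binder of closes (by-name cross-link keeps 2B's ranks untouched —
critic's preference)] [support · CROSS-LINK to route RootDecompCycle2B, NOT separately staffed: =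
26352 EnergyLanding → 26353 LoudnessRecurrence → 26354 WindowBookkeeping composed (kernel:
DwellLadder.stretchSustainment_of_2B over RootDecompCycle2B.closes); PIECE WEAKER-formal (S ⟹ it);
closes when 2B's declared residuals close] STRETCH SUSTAINMENT: 2B's loud stretches (26351-text) ⇒
the zeroth law. [decomp-ad lens-1 g7 DwellLadder; node HOME/decomp-ad-lens-1/DwellLadder.lean sha256
ef85cfd8… (443 lines, farm rc0 · 0 sorry · 0 warn), card DwellLadder_NODE.md 498c8645…, probes
DwellLadder_bc7.out.txt + _bc7b.out.txt 15/15 CLEAN; critic CLEARED 2026-08-30T06:16:09Z; writer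
check of split_g7/glue_child.lean rc0 · 0 sorry (inlined texts, closes, refines : 1D.Autonomisation,
shared ↔ 1D := Iff.rfl ×2)] -/
@[route_item "route-AnomalousDissipation-DwellLadder", crux]
def StretchSustainment : Prop :=
  (∃ (f : UnitAddTorus (Fin 3) → EuclideanSpace ℝ (Fin 3)) (ν : ℕ → ℝ) (E₀ E ε : ℝ), (Literature.Analysis.FunctionSpaces.Torus.IsSmooth f ∧ Literature.Analysis.FunctionSpaces.Torus.IsDivFree f ∧ Literature.Analysis.FunctionSpaces.Torus.HasZeroMean f ∧ (∀ j, 0 < ν j) ∧ Tendsto ν atTop (𝓝 0) ∧ 0 < ε) ∧ ∀ τ : ℝ, ∃ j₀ : ℕ, ∀ j, j₀ ≤ j → ∃ T₀ : ℝ, 0 < T₀ ∧ ∃ (K : ℝ → ℕ) (u₀ : UnitAddTorus (Fin 3) → EuclideanSpace ℝ (Fin 3)) (u : ℝ → UnitAddTorus (Fin 3) → EuclideanSpace ℝ (Fin 3)), ∫ x, ‖u₀ x‖ ^ 2 ≤ E₀ ∧ Literature.Analysis.FluidPDE.Torus.IsGlobalLerayHopf (ν j) (fun _ => f) u₀ u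 ∧ ∀ T : ℝ, T₀ ≤ T → T ≤ T₀ + τ → Literature.Analysis.FluidPDE.timeMean (fun t => ∫ x, ‖u t x‖ ^ 2) T ≤ E ∧ ε ≤ Literature.Analysis.FluidPDE.timeMean (fun t => (ν j) * (Literature.Analysis.FunctionSpaces.Torus.eGradNormSq (Literature.Analysis.FunctionSpaces.Torus.fourierTruncate (K T) (u t))).toReal) T) → _root_.AnomalousDissipation

-- parent: StretchSustainment · child (gen 1)
/--     item stmt-AnomalousDissipation-30103 · crux · rank 901 · open
    parent: StretchSustainment · by planner
    why it might fail: W_lifetime: at each fixed ν every bounded-energy Leray–Hopf run under f may turn quiet or fat within a time τ_life(ν) < ∞ (τ_life(ν_j) → ∞ gives the ν-uniform stretches, but no window longer than τ_life(ν_j) at index j) — finite lifetime of box turbulence at fixed Re with no loud bounded invariant s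
    sources: doi:10.1103/PhysRevLett.115.134502, doi:10.1016/j.fluiddyn.2005.09.001, doi:10.1017/jfm.2017.97, arXiv:2502.06475, FMRTTurbulence2001, DoeringFoias2002
[crux · rank 6 · NEW DECLARED RESIDUAL of DwellLadder (replaces 29227 as the open top-grade edge) ·
fixed-ν HORIZON EXTENSION in POWER currency: 2B:26351 LoudStretches (ν-uniform finite loud stretches
∀τ ∃j₀ ∀j≥j₀) ⟹ LoudWindows:24058 LongLoudWindows (∀j ∀T₀ ∃T≥T₀ loud bounded windows at EACH fixed
ν) — a single QUANTIFIER-ORDER cut, no Λ_j rungs · WEAKER: kernel X ⟹ W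
(horizonExtension_of_stretchSustainment), S ⟹ W (horizonExtension_of_summit), and W is kernel-BELOW
every typed sustainment residual of the cell — 2B 26352∧26353∘26354 (horizonExtension_of_twoB),
LoudWindows 24265 Reloading (horizonExtension_of_reloading), DissipativeChain 25956∧25957
(horizonExtension_of_chain): the INFIMUM of the «horizon-extension» axis, counted ONCE in TREE.md ·
EXACT: (LongLoudWindows → S) → (X ↔ W) (stretchSustainment_iff_horizonExtension) ·
UNDECIDED(T-HORIZON: does the longest β-loud bounded window at ν_j grow without bound at fixed
budgets?) + IDEA-NEEDED (loud bounded invariant states / unbounded loud lifetimes per ν) ·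
separating world W_defect = lens-3's 26821 object (long loud windows at every ν, Leray–Hopf energy
defect on every infinite-time realisation; Cheskidov class) · text inlined -/
@[route_item "route-AnomalousDissipation-DwellLadder"]
def HorizonExtension : Prop :=
  (∃ (f : UnitAddTorus (Fin 3) → EuclideanSpace ℝ (Fin 3)) (ν : ℕ → ℝ) (E₀ E ε : ℝ), (Literature.Analysis.FunctionSpaces.Torus.IsSmooth f ∧ Literature.Analysis.FunctionSpaces.Torus.IsDivFree f ∧ Literature.Analysis.FunctionSpaces.Torus.HasZeroMean f ∧ (∀ j, 0 < ν j) ∧ Tendsto ν atTop (𝓝 0) ∧ 0 < ε) ∧ ∀ τ : ℝ, ∃ j₀ : ℕ, ∀ j, j₀ ≤ j → ∃ T₀ : ℝ, 0 < T₀ ∧ ∃ (K : ℝ → ℕ) (u₀ : UnitAddTorus (Fin 3) → EuclideanSpace ℝ (Fin 3)) (u : ℝ → UnitAddTorus (Fin 3) → EuclideanSpace ℝ (Fin 3)), ∫ x, ‖u₀ x‖ ^ 2 ≤ E₀ ∧ Literature.Analysis.FluidPDE.Torus.IsGlobalLerayHopf (ν j) (fun _ => f) u₀ u ∧ ∀ T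 : ℝ, T₀ ≤ T → T ≤ T₀ + τ → Literature.Analysis.FluidPDE.timeMean (fun t => ∫ x, ‖u t x‖ ^ 2) T ≤ E ∧ ε ≤ Literature.Analysis.FluidPDE.timeMean (fun t => (ν j) * (Literature.Analysis.FunctionSpaces.Torus.eGradNormSq (Literature.Analysis.FunctionSpaces.Torus.fourierTruncate (K T) (u t))).toReal) T) → ∃ f : UnitAddTorus (Fin 3) → EuclideanSpace ℝ (Fin 3), Literature.Analysis.FunctionSpaces.Torus.IsSmooth f ∧ Literature.Analysis.FunctionSpaces.Torus.IsDivFree f ∧ Literature.Analysis.FunctionSpaces.Torus.HasZeroMean f ∧ ∃ ν : ℕ → ℝ, (∀ j, 0 < ν j) ∧ Filter.Tendsto ν Filter.atTop (nhds 0) ∧ ∃ E β : ℝ, 0 < β ∧ ∀ j : ℕ, ∀ T₀ : ℝ, ∃ T : ℝ, T₀ ≤ T ∧ ∃ (u₀ : UnitAddTorus (Fin 3) → EuclideanSpace ℝ (Fin 3)) (u : ℝ → UnitAddTorus (Fin 3) → EuclideanSpace ℝ (Fin 3)), Literature.Analysis.FluidPDE.Torus.IsGlobalLerayHopf (ν j)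 (fun _ => f) u₀ u ∧ Literature.Analysis.FluidPDE.timeMean (fun t => ∫ x, ‖u t x‖ ^ 2) T ≤ E ∧ β ≤ Literature.Analysis.FluidPDE.timeMean (fun t => ∫ x, inner ℝ (f x) (u t x)) T

-- parent: StretchSustainment · child (gen 1)
/--     item stmt-AnomalousDissipation-30104 · support · rank 902 · open
    parent: StretchSustainment · by planner
    sources: DoeringFoias2002
[support · CROSS-LINK BY NAME := LoudWindows.WindowCompactness = item 24059 (THEOREM-GRADE L,
ATTACKABLE NOW — staffed on route LoudWindows, NOT here; closes by `id` the moment 24059 is proved).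
Why by name and not «shared by signature»: LoudWindows files 24059 as `LongLoudWindows →
PowerFloorFamily` over its own decls, so an inlined copy would NOT merge under the signature
normaliser (cf. StrainDichotomy 29900 vs 2A 25780) and would be staffed twice; the alias makes the
identity kernel-literal (chk_K := Iff.rfl); lens-1 g8 NODE HorizonJunction
(HOME/decomp-ad-lens-1/HorizonJunction.lean sha256 e211a135…, lean rc0 · 0 sorry; card
HorizonJunction_NODE.md 6038f228…; probes HorizonJunction_bc7.out.txt 6/6 CLEAN; crit-1 CLEARED
2026-08-30T07:01:59Z; writer paste check g4/HJ/SketchHJ.lean rc0: chk_W/chk_K/chk_T/chk_SF :=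
Iff.rfl, glue, closes)] WINDOW COMPACTNESS (K): long loud bounded windows at each fixed ν ⟹ a
power-floor family (LoudWindows 24058 → 24057). -/
@[route_item "route-AnomalousDissipation-DwellLadder"]
def WindowCompactnessLink : Prop :=
  Summit.AnomalousDissipation.AnomalousDissipation.Theses.LoudWindows.WindowCompactness

-- parent: StretchSustainment · child (gen 1)
/--     item stmt-AnomalousDissipation-30105 · support · rank 903 · open
    parent: StretchSustainment · by planner
    sources: DoeringFoias2002, Frisch1995
[support · CROSS-LINK BY NAME := LoudWindows.PowerRealisesDissipation = item 24060 (lens-3's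
DECLARED TOLL of LoudWindows, not re-split here; staffed/accounted on LoudWindows; closes by `id`
when 24060 does); same by-name rationale as WindowCompactnessLink (chk_T := Iff.rfl); lens-1 g8 NODE
HorizonJunction (HOME/decomp-ad-lens-1/HorizonJunction.lean sha256 e211a135…, lean rc0 · 0 sorry;
card HorizonJunction_NODE.md 6038f228…; probes HorizonJunction_bc7.out.txt 6/6 CLEAN; crit-1 CLEARED
2026-08-30T07:01:59Z; writer paste check g4/HJ/SketchHJ.lean rc0: chk_W/chk_K/chk_T/chk_SF :=
Iff.rfl, glue, closes)] POWER REALISES DISSIPATION (T): a power-floor family ⟹ the zeroth law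
(LoudWindows 24057 → S). -/
@[route_item "route-AnomalousDissipation-DwellLadder"]
def PowerRealisesDissipationLink : Prop :=
  Summit.AnomalousDissipation.AnomalousDissipation.Theses.LoudWindows.PowerRealisesDissipation

-- parent: StretchSustainment · glue (gen 1)
/--     item stmt-AnomalousDissipation-30106 · support · rank 904 · closed · proved by Summit.AnomalousDissipation.AnomalousDissipation.Theorems.CellGlue.stretchSustainmentGlue_holds (prover)
    parent: StretchSustainment · GLUE: children ⟹ parent · by planner
HorizonExtension → WindowCompactnessLink → PowerRealisesDissipationLink → StretchSustainment —
PROVABLE NOW by three modus ponens modulo unfolding (node splitGlue_holds l.110 / writer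
SketchHJ.lean stretchSustainmentGlue_holds := fun hW hK hT hLS => hT (hK (hW hLS)), rc0): W turns
ν-uniform finite loud stretches (2B:26351) into long loud bounded windows at each fixed ν
(LoudWindows:24058), K = LoudWindows:24059 compacts them into a power-floor family, T =
LoudWindows:24060 realises dissipation. decomp-ad lens-1 g8 NODE HorizonJunction, crit-1 CLEARED
2026-08-30T07:01:59Z (form = writer in-place split). -/
@[route_item "route-AnomalousDissipation-DwellLadder"]
def StretchSustainmentGlue : Prop :=
  HorizonExtension → WindowCompactnessLink → PowerRealisesDissipationLink → StretchSustainment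

-- `StretchSustainmentGlue` holds: proved by `Summit.AnomalousDissipation.AnomalousDissipation.Theorems.CellGlue.stretchSustainmentGlue_holds` (its module imports this route file, so no `_holds` link can be stated here).

/-- item stmt-AnomalousDissipation-30102 · support · rank 9 · closed · proved by Summit.AnomalousDissipation.AnomalousDissipation.Theorems.StretchFeeds.stretchFeeds_holds (prover) · by planner
why it might fail: It cannot: kernel-checked in the node file (0 sorry); port-size risk only (timeMean bookkeeping, Doering–Foias power bound constants).
sources: DoeringFoias2002, Leray1934, RobinsonRodrigoSadowski2016
[support · JUNCTION LEMMA · PROVED in the node file (stretchFeeds_holds l.292, 0 sorry: j ↦ j+j₀(τ),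
β = ε/2, τ = E₀/ε + 2048(E+1)²(‖f‖₂²+1)/ε³ + 1) → port to Theorems/; first typed junction 2B ⟶
LoudWindows: 2B:26351 LoudStretches ⟹ LoudWindows:24264 FedCascadeWindow (so 24264 closes the day
26351 does); text inlined over Literature tokens = (26351-text) → (24264-text), certified chk_SF :
StretchFeeds ↔ (RootDecompCycle2B.LoudStretches → LoudWindows.FedCascadeWindow) := Iff.rfl; lens-1
g8 NODE HorizonJunction (HOME/decomp-ad-lens-1/HorizonJunction.lean sha256 e211a135…, lean rc0 · 0
sorry; card HorizonJunction_NODE.md 6038f228…; probes HorizonJunction_bc7.out.txt 6/6 CLEAN; crit-1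
CLEARED 2026-08-30T07:01:59Z; writer paste check g4/HJ/SketchHJ.lean rc0: chk_W/chk_K/chk_T/chk_SF
:= Iff.rfl, glue, closes)] [support · PROVABLE NOW · PROOF SUPPLIED (node file §3
`stretchFeeds_holds`, ≈ 90 lines over tree lemmas
Torus.IsLerayHopfOn.intervalIntegral_dissipation_le, Torus.eGradNormSq_eq_add_fourierTruncate,
IsLerayHopfOn.tendsto_setIntegral_toReal_eGradNormSq_fourierTruncate,
IsGlobalLerayHopf.integrableOn_toReal_eGradNormSq; a prover ports it to Theorems/, size S–M) ·
JUNCTION LEMMA 2B -/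
@[route_item "route-AnomalousDissipation-DwellLadder"]
def StretchFeeds : Prop :=
  (∃ (f : UnitAddTorus (Fin 3) → EuclideanSpace ℝ (Fin 3)) (ν : ℕ → ℝ) (E₀ E ε : ℝ), (Literature.Analysis.FunctionSpaces.Torus.IsSmooth f ∧ Literature.Analysis.FunctionSpaces.Torus.IsDivFree f ∧ Literature.Analysis.FunctionSpaces.Torus.HasZeroMean f ∧ (∀ j, 0 < ν j) ∧ Tendsto ν atTop (𝓝 0) ∧ 0 < ε) ∧ ∀ τ : ℝ, ∃ j₀ : ℕ, ∀ j, j₀ ≤ j → ∃ T₀ : ℝ, 0 < T₀ ∧ ∃ (K : ℝ → ℕ) (u₀ : UnitAddTorus (Fin 3) → EuclideanSpace ℝ (Fin 3)) (u : ℝ → UnitAddTorus (Fin 3) → EuclideanSpace ℝ (Fin 3)), ∫ x, ‖u₀ x‖ ^ 2 ≤ E₀ ∧ Literature.Analysis.FluidPDE.Torus.IsGlobalLerayHopf (ν j) (fun _ => f) u₀ u ∧ ∀ T : ℝ, T₀ ≤ T → T ≤ T₀ + τ → Literature.Analysis.FluidPDE.timeMean (fun t => ∫ x, ‖u t x‖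 ^ 2) T ≤ E ∧ ε ≤ Literature.Analysis.FluidPDE.timeMean (fun t => (ν j) * (Literature.Analysis.FunctionSpaces.Torus.eGradNormSq (Literature.Analysis.FunctionSpaces.Torus.fourierTruncate (K T) (u t))).toReal) T) → ∃ f : UnitAddTorus (Fin 3) → EuclideanSpace ℝ (Fin 3), Literature.Analysis.FunctionSpaces.Torus.IsSmooth f ∧ Literature.Analysis.FunctionSpaces.Torus.IsDivFree f ∧ Literature.Analysis.FunctionSpaces.Torus.HasZeroMean f ∧ ∃ ν : ℕ → ℝ, (∀ j, 0 < ν j) ∧ Filter.Tendsto ν Filter.atTop (nhds 0) ∧ ∃ E β : ℝ, 0 < β ∧ ∀ j : ℕ, ∃ T : ℝ, 256 * (E + 1) ^ 2 * ((∫ x, ‖f x‖ ^ 2) + 1) ≤ β ^ 3 * T ∧ ∃ (u₀ : UnitAddTorus (Fin 3) → EuclideanSpace ℝ (Fin 3)) (u : ℝ → UnitAddTorus (Fin 3) → EuclideanSpace ℝ (Fin 3)), Literature.Analysis.FluidPDE.Torus.IsGlobalLerayHopf (ν j) (fun _ => f) u₀ u ∧ Literature.Analysis.FluidPDE.timeMean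 (fun t => ∫ x, ‖u t x‖ ^ 2) T ≤ E ∧ β ≤ Literature.Analysis.FluidPDE.timeMean (fun t => ∫ x, inner ℝ (f x) (u t x)) T

-- `StretchFeeds` holds: proved by `Summit.AnomalousDissipation.AnomalousDissipation.Theorems.StretchFeeds.stretchFeeds_holds` (its module imports this route file, so no `_holds` link can be stated here).

/-- item stmt-AnomalousDissipation-29228 · assembly · rank 1 · open · by planner
sources: HOME/decomp-ad-lens-1/DwellLadder.lean
[assembly] StirredLogLaw → StirredDelog → DwellDown → DwellExtraction → StretchSustainment →
AnomalousDissipation (= the lens closes'; the deciding theorem is glue.lean `closes := hS (hX (hD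
(h₂ h₁)))`). -/
@[route_item "route-AnomalousDissipation-DwellLadder"]
def Assembly : Prop :=
  StirredLogLaw → StirredDelog → DwellDown → DwellExtraction → StretchSustainment → _root_.AnomalousDissipation

/-! D-0027 §2.1 — DECIDING THEOREM (planner-authored via `route open/edit --closes-file`; by planner-decomp-ad-writer-1-g3-0 2026-08-30T06:22:11Z):
its hypotheses are this route's items and its conclusion the sub-problem Statement (glue_lint), and it elaborates with this file. -/

@[closes "route-AnomalousDissipation-DwellLadder"] theorem closes (h₁ : StirredLogLaw) (h₂ : StirredDelog) (hD : DwellDown) (hX : DwellExtraction) (hS : StretchSustainment) :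
    _root_.AnomalousDissipation :=
  hS (hX (hD (h₂ h₁)))

end Summit.AnomalousDissipation.AnomalousDissipation.Theses.DwellLadder
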